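import Literature.RepresentationTheory.CompactAbelianTypeDichotomy
import HarnessLib

/-!
# From a SHIFTED type dichotomy to the EXACT one: complementary-up-to-`θ` type sets that are DISJOINT are complementary
# (the shift `θ` of ★ `finrank_weightSpace_add_eq_one_of_trace_eq_neg` is invisible once no character occurs on both sides)

Topic `RepresentationTheory`; namespace `Literature.RepresentationTheory.TwistedCoinv` (continuing `CompactAbelianTypeDichotomy`).  KERNEL ONLY:
theorems, 0 definitions, 0 named facts, 0 `sorry`.

THE POINT.  The tree's abstract `(U(1), U(1))` dichotomy ★ `finrank_weightSpace_add_eq_one_of_trace_eq_neg` (and its consumer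
★ `MoeglinVignerasWaldspurger1987.rankOne_theta_dichotomy`) concludes `dim S₁[ξ] + dim S₂[ξ·θ] = 1` for every open-kernel `ξ` of the compact
group `K`, with an UNSPECIFIED open-kernel character `θ` (the ratio of the two finite-level characters — for two oscillator representations, the
ratio of the two sections' scalars).  The print statement [HarrisKudlaSweet1996 Cor. 4.4 (m = n = 1); Rogawski1992 Prop. 3.4; MVW Chap. 3 §IV.4]
for MATCHED normalisations is the EXACT dichotomy `dim S₁[ξ] + dim S₂[ξ] = 1`.  This file proves the bookkeeping half of the passage:

* `finrank_weightSpace_add_eq_one_of_shift_of_disjoint` — if `dim S₁[ξ] + dim S₂[ξ·θ] = 1` for all open-kernel `ξ` (SHIFTED dichotomy, `θ` with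
  open kernel) and NO open-kernel `ξ` occurs in both (`dim S₁[ξ] = 0 ∨ dim S₂[ξ] = 0`, DISJOINTNESS), then `dim S₁[ξ] + dim S₂[ξ] = 1` for all
  open-kernel `ξ`.  Proof: write `A = {ξ | dim S₁[ξ] = 1}`; the shifted dichotomy says `dim S₂[η] = 1 − [η θ⁻¹ ∈ A]`, so disjointness reads
  `ξ ∈ A ⇒ ξ θ⁻¹ ∈ A`; the kernel of `θ` is open in the COMPACT `K`, so `K ⧸ ker θ` is finite and `θⁿ = 1` for `n = |K ⧸ ker θ|`; iterating the
  implication `n − 1` times from `ξ θ⁻¹` gives the converse `ξ θ⁻¹ ∈ A ⇒ ξ = (ξθ⁻¹)·θ^{-(n-1)} ∈ A`; hence `A` is `θ`-stable and the shift drops out.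
* `pow_natCard_quotient_ker_eq_one` ∕ `pow_natCard_quotient_ker` — `θ ^ |K ⧸ ker θ| = 1` (finite order when the kernel is open and `K` compact); `isOpen_ker_mul` ∕ `isOpen_ker_mul_pow`.

So the in-house payment of the exact dichotomy (e.g. the CM-currency letter ★ `GelbartRogawski1991.u1ThetaDichotomy_nonsplit`, via
`Summit…F0P2oK1occ.u1ThetaDichotomy_nonsplit_of_dichotomy`) needs, beyond ★ `rankOne_theta_dichotomy` and transport, ONLY the disjointness
«no character occurs in both oscillator representations of two lines in different classes» — the rank-`(1,1)` twin of ★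
`rankOne_theta_lines_disjoint` — and never the value of `θ`.  Cell `hodgecm-mathlib` (D-0151), FLOOR 0, crux H413, K1 sub-line of the U′-N
pay-down (F0∕P2 bus 2026-08-31T15:55Z (2)); HC_CM is proved only modulo the printed citations until rung 0 closes — nothing here is a letter.

## References
* [MoeglinVignerasWaldspurger1987] LNM 1291 (1987), Chap. 3 §IV.4 (the `(U(1),U(1))` dichotomy).
* [HarrisKudlaSweet1996] JAMS 9 (1996), Cor. 4.4 p. 962 (m = n = 1).
* [BernsteinZelevinsky1976] Russian Math. Surveys 31 (1976), §2.1 (open kernels, finite quotients of compact groups).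
-/

set_option autoImplicit false

noncomputable section

namespace Literature.RepresentationTheory.TwistedCoinv

variable {K : Type*} [Group K] [TopologicalSpace K] [IsTopologicalGroup K] [CompactSpace K]

omit [TopologicalSpace K] [IsTopologicalGroup K] [CompactSpace K] in
/-- **`θ(k) ^ |K ⧸ ker θ| = 1`** for a character `θ` (`k̄ ^ |K ⧸ ker θ| = 1` in the quotient; when the quotient is infinite `Nat.card = 0` and the
statement is trivial — for an open kernel in a compact group the quotient is finite and this is the finite order of `θ`).
[cite: BernsteinZelevinsky1976, §2.1] -/
theorem pow_natCard_quotient_ker_eq_one (θ : K →* ℂˣ) (k : K) : θ k ^ Nat.card (K ⧸ θ.ker) = 1 := by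
  have h : ((k : K ⧸ θ.ker)) ^ Nat.card (K ⧸ θ.ker) = 1 := pow_card_eq_one'
  rw [← QuotientGroup.mk_pow, QuotientGroup.eq_one_iff, MonoidHom.mem_ker, map_pow] at h
  exact h

omit [TopologicalSpace K] [IsTopologicalGroup K] [CompactSpace K] in
/-- `θ ^ |K ⧸ ker θ| = 1` as a character. [cite: BernsteinZelevinsky1976, §2.1] -/
theorem pow_natCard_quotient_ker (θ : K →* ℂˣ) : θ ^ Nat.card (K ⧸ θ.ker) = 1 :=
  MonoidHom.ext fun k => by rw [MonoidHom.pow_apply, MonoidHom.one_apply, pow_natCard_quotient_ker_eq_one θ k]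

omit [CompactSpace K] in
/-- the kernel of a product of two characters contains the intersection of the kernels, hence is open when both are. [cite: BernsteinZelevinsky1976, §2.1] -/
theorem isOpen_ker_mul (ξ θ : K →* ℂˣ) (hξ : IsOpen (ξ.ker : Set K)) (hθ : IsOpen (θ.ker : Set K)) :
    IsOpen ((ξ * θ).ker : Set K) := by
  refine Subgroup.isOpen_mono (H₁ := ξ.ker ⊓ θ.ker) ?_ (by rw [Subgroup.coe_inf]; exact hξ.inter hθ)
  intro k hk
  rw [Subgroup.mem_inf, MonoidHom.mem_ker, MonoidHom.mem_ker] at hk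
  rw [MonoidHom.mem_ker, MonoidHom.mul_apply, hk.1, hk.2, one_mul]

omit [CompactSpace K] in
/-- open kernels are stable under multiplication by powers of an open-kernel character. [cite: BernsteinZelevinsky1976, §2.1] -/
theorem isOpen_ker_mul_pow (ξ θ : K →* ℂˣ) (hξ : IsOpen (ξ.ker : Set K)) (hθ : IsOpen (θ.ker : Set K)) (m : ℕ) :
    IsOpen ((ξ * θ ^ m).ker : Set K) := by
  induction m with
  | zero =>
    have e : ξ * θ ^ 0 = ξ := MonoidHom.ext fun k => by rw [MonoidHom.mul_apply, MonoidHom.pow_apply, pow_zero, mul_one]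
    rw [e]; exact hξ
  | succ m ih =>
    have e : ξ * θ ^ (m + 1) = ξ * θ ^ m * θ := MonoidHom.ext fun k => by
      simp only [MonoidHom.mul_apply, MonoidHom.pow_apply, pow_succ, mul_assoc]
    rw [e]; exact isOpen_ker_mul _ _ ih hθ

variable {S₁ S₂ : Type*} [AddCommGroup S₁] [Module ℂ S₁] [AddCommGroup S₂] [Module ℂ S₂]
  (ρ₁ : Representation ℂ K S₁) (ρ₂ : Representation ℂ K S₂)

/-- **FROM THE SHIFTED DICHOTOMY TO THE EXACT ONE.**  Let `θ` be a character of the compact group `K` with open kernel.  If for every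
open-kernel character `ξ` one has `dim S₁[ξ] + dim S₂[ξ·θ] = 1` (the conclusion of ★ `finrank_weightSpace_add_eq_one_of_trace_eq_neg`) and the
two type sets are DISJOINT (`dim S₁[ξ] = 0 ∨ dim S₂[ξ] = 0`), then `dim S₁[ξ] + dim S₂[ξ] = 1` for every open-kernel `ξ` — the shift `θ` drops
out: disjointness gives `dim S₁[ξθ] = 1 ⇒ dim S₁[ξ] = 1`, and `θ` has finite order `n = |K ⧸ ker θ|`, so descending `n − 1` steps from
`ξθⁿ = ξ` closes the circle. [cite: MoeglinVignerasWaldspurger1987, Chap. 3 §IV.4] [cite: HarrisKudlaSweet1996, Cor. 4.4 p. 962] -/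
theorem finrank_weightSpace_add_eq_one_of_shift_of_disjoint (θ : K →* ℂˣ) (hθ : IsOpen (θ.ker : Set K))
    (hshift : ∀ ξ : K →* ℂˣ, IsOpen (ξ.ker : Set K) →
      Module.finrank ℂ (weightSpace ρ₁ id (fun k => ((ξ k : ℂˣ) : ℂ))) +
        Module.finrank ℂ (weightSpace ρ₂ id (fun k => (((ξ * θ) k : ℂˣ) : ℂ))) = 1)
    (hdisj : ∀ ξ : K →* ℂˣ, IsOpen (ξ.ker : Set K) →
      Module.finrank ℂ (weightSpace ρ₁ id (fun k => ((ξ k : ℂˣ) : ℂ))) = 0 ∨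
        Module.finrank ℂ (weightSpace ρ₂ id (fun k => ((ξ k : ℂˣ) : ℂ))) = 0)
    (ξ : K →* ℂˣ) (hξ : IsOpen (ξ.ker : Set K)) :
    Module.finrank ℂ (weightSpace ρ₁ id (fun k => ((ξ k : ℂˣ) : ℂ))) +
      Module.finrank ℂ (weightSpace ρ₂ id (fun k => ((ξ k : ℂˣ) : ℂ))) = 1 := by
  -- notation: `a η = dim S₁[η]`, `b η = dim S₂[η]`
  set a : (K →* ℂˣ) → ℕ := fun η => Module.finrank ℂ (weightSpace ρ₁ id (fun k => ((η k : ℂˣ) : ℂ))) with ha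
  set b : (K →* ℂˣ) → ℕ := fun η => Module.finrank ℂ (weightSpace ρ₂ id (fun k => ((η k : ℂˣ) : ℂ))) with hb
  have hshift' : ∀ η : K →* ℂˣ, IsOpen (η.ker : Set K) → a η + b (η * θ) = 1 := fun η hη => hshift η hη
  have hdisj' : ∀ η : K →* ℂˣ, IsOpen (η.ker : Set K) → a η = 0 ∨ b η = 0 := fun η hη => hdisj η hη
  -- disjointness ⇒ the descending step `a (η θ) = 1 → a η = 1`
  have hstep : ∀ η : K →* ℂˣ, IsOpen (η.ker : Set K) → a (η * θ) = 1 → a η = 1 := by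
    intro η hη h1
    have hs := hshift' η hη
    rcases hdisj' (η * θ) (isOpen_ker_mul _ _ hη hθ) with h0 | h0
    · exact absurd h1 (by rw [h0]; exact zero_ne_one)
    · omega
  -- iterate: `a (η θ^(m + j)) = 1 → a (η θ^m) = 1`
  have hiter : ∀ (j m : ℕ) (η : K →* ℂˣ), IsOpen (η.ker : Set K) → a (η * θ ^ (m + j)) = 1 → a (η * θ ^ m) = 1 := by
    intro j
    induction j with
    | zero => intro m η _ h1; rwa [add_zero] at h1
    | succ j ih =>
      intro m η hη h1
      have e : η * θ ^ (m + (j + 1)) = η * θ ^ (m + j) * θ := MonoidHom.ext fun k => by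
        simp only [MonoidHom.mul_apply, MonoidHom.pow_apply, ← add_assoc, pow_succ, mul_assoc]
      rw [e] at h1
      exact ih m η hη (hstep _ (isOpen_ker_mul_pow _ _ hη hθ _) h1)
  -- `θ` has finite order `n = |K ⧸ ker θ| ≥ 1`
  set n : ℕ := Nat.card (K ⧸ θ.ker) with hn
  haveI : Finite (K ⧸ θ.ker) := Subgroup.quotient_finite_of_isOpen θ.ker hθ
  have hn0 : 0 < n := Nat.card_pos
  have hθn : θ ^ n = 1 := pow_natCard_quotient_ker θ
  -- `b ξ = 1 - a (ξ θ^(n-1))` (shifted dichotomy at `ξ θ^(n-1)`, since `ξ θ^(n-1) · θ = ξ θⁿ = ξ`)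
  have e1 : ξ * θ ^ (n - 1) * θ = ξ := by
    have : ξ * θ ^ (n - 1) * θ = ξ * θ ^ n := MonoidHom.ext fun k => by
      simp only [MonoidHom.mul_apply, MonoidHom.pow_apply, mul_assoc, ← pow_succ, Nat.sub_add_cancel hn0]
    rw [this, hθn]
    exact MonoidHom.ext fun k => by rw [MonoidHom.mul_apply, MonoidHom.one_apply, mul_one]
  have hbξ : a (ξ * θ ^ (n - 1)) + b ξ = 1 := by
    have h := hshift' (ξ * θ ^ (n - 1)) (isOpen_ker_mul_pow _ _ hξ hθ _)
    rwa [e1] at h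
  -- `a ξ = 1 ↔ a (ξ θ^(n-1)) = 1`
  have e0 : ξ * θ ^ 0 = ξ := MonoidHom.ext fun k => by rw [MonoidHom.mul_apply, MonoidHom.pow_apply, pow_zero, mul_one]
  have en : ξ * θ ^ n = ξ := by
    rw [hθn]; exact MonoidHom.ext fun k => by rw [MonoidHom.mul_apply, MonoidHom.one_apply, mul_one]
  have hup : a ξ = 1 → a (ξ * θ ^ (n - 1)) = 1 := by
    intro h1
    refine hstep _ (isOpen_ker_mul_pow _ _ hξ hθ _) ?_
    rw [e1]; exact h1
  have hdown : a (ξ * θ ^ (n - 1)) = 1 → a ξ = 1 := by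
    intro h1
    have h := hiter (n - 1) 0 ξ hξ (by rw [zero_add]; exact h1)
    rwa [e0] at h
  -- conclude
  have ha1 : a ξ ≤ 1 := by have := hshift' ξ hξ; omega
  change a ξ + b ξ = 1
  by_cases h1 : a ξ = 1
  · have := hup h1; omega
  · have : a (ξ * θ ^ (n - 1)) ≠ 1 := fun h => h1 (hdown h)
    omega

end Literature.RepresentationTheory.TwistedCoinv

end
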